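import Summits.QuantumFields.YangMills.Theorems.IR.DefectChainPriceDefs
import Literature.MathematicalPhysics.QuantumFieldTheory.LatticeGaugeProofs
import Literature.MathematicalPhysics.QuantumFieldTheory.YangMillsOS
import HarnessLib

/-!
# Crux `IR` (stmt-QuantumFields-19354) — line `defect-chain-price` (ym-ir-idea-3), support stub S1 `ChainRarity`:
# the COMBINATORICS of defect chains on the torus (cycle distance, time displacement, disjointness, counting)

Helper module for item `stmt-QuantumFields-19354` (`--supports … --as helper`; it closes nothing).  Pooled prover
ym-ir-line-pool-p3 (g13).  Finite combinatorics on the torus `(ℤ/L)⁴` for the proof of `ChainRarity`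
(`Theorems/IR/DefectChainRarity.lean`) over the vocabulary `Theorems/IR/DefectChainPriceDefs.lean`:

* §1 the cycle distance `znorm z = min(z.val, L − z.val) = |z.valMinAbs|`: symmetry, triangle inequality, value on
  differences of small naturals, `#{z | znorm z ≤ b} ≤ 2b+1`, `#{z | znorm z < ℓ} ≤ 2ℓ`;
* §2 the time displacement along a chain: consecutive base sites at sup-distance `≤ 2` ⇒ the `i`-th plaquette's time
  coordinate is within cycle distance `2i` of the first (`znorm_chain_le`);
* §3 DISJOINTNESS: on the torus `2S+1` with `m ℓ ≤ S` and `2k ≤ ℓ`, chains of `k+1` plaquettes starting in tube boxes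
  `j ≠ j'` (`j, j' < m`) of the SAME residue class mod `3` have disjoint plaquette sets (`disjoint_image_chains`) — the
  boxes are `≥ 2ℓ+1 > 4k` apart in time;
* §4 COUNTING: the tube box `j` of side `ℓ` has `≤ 8ℓ⁴` sites (`card_filter_tubeBox_le`) and the chains of `k+1`
  plaquettes starting in it number `≤ 8ℓ⁴·m·(625 m)^k`, `m = #orientations = 6` (`exists_chainFinset`: difference coding
  `c ↦ (c 0, (c i − c (i+1), orientation (i+1))_i)` is injective and each difference has all four coordinates at cycle
  distance `≤ 2`, `5⁴ = 625` choices);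
* §5 pigeonhole over residues mod `3` (`card_le_three_mul_residue`) and `⌈x⌉₊ < |x| + 1` (`natCeil_lt_abs_add_one`).

Everything is proved (no `sorry`, standard axioms, no definitions).  HONEST FRAMING: lattice bookkeeping; nothing here bears on
`BalabanLadder.IR`, confinement, a lattice gap or the Yang–Mills mass gap (Clay), which are NOT proved; `R4` closes only the
conditional finite-𝕋⁴ rung `BalabanLadder.UV`.
-/

set_option autoImplicit false

noncomputable section

open Finset Function
open Literature.MathematicalPhysics.QuantumFieldTheory

namespace Summit.QuantumFields.YangMills.Cruxes.IR.DefectChain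

/-! ## §1 The cycle distance `znorm` -/

section ZNorm

variable {L : ℕ} [NeZero L]

/-- `znorm z = |z.valMinAbs|`. -/
theorem znorm_eq_natAbs (z : ZMod L) : znorm z = z.valMinAbs.natAbs :=
  (ZMod.valMinAbs_natAbs_eq_min z).symm

/-- `znorm 0 = 0`. -/
@[simp] theorem znorm_zero : znorm (0 : ZMod L) = 0 := by
  simp [znorm_eq_natAbs]

/-- `znorm (−z) = znorm z`. -/
theorem znorm_neg (z : ZMod L) : znorm (-z) = znorm z := by
  rw [znorm_eq_natAbs, znorm_eq_natAbs, ZMod.natAbs_valMinAbs_neg]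

/-- `znorm (a − b) = znorm (b − a)`. -/
theorem znorm_sub_comm (a b : ZMod L) : znorm (a - b) = znorm (b - a) := by
  rw [← znorm_neg, neg_sub]

/-- Triangle inequality: `znorm (x + y) ≤ znorm x + znorm y`. -/
theorem znorm_add_le (x y : ZMod L) : znorm (x + y) ≤ znorm x + znorm y := by
  rw [znorm_eq_natAbs, znorm_eq_natAbs, znorm_eq_natAbs]
  exact (ZMod.natAbs_valMinAbs_add_le x y).trans (Int.natAbs_add_le _ _)

/-- Triangle inequality for differences: `znorm (a − c) ≤ znorm (a − b) + znorm (b − c)`. -/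
theorem znorm_sub_le (a b c : ZMod L) : znorm (a - c) ≤ znorm (a - b) + znorm (b - c) := by
  have h : a - c = (a - b) + (b - c) := by abel
  rw [h]
  exact znorm_add_le _ _

/-- `znorm z ≤ L / 2`. -/
theorem znorm_le_half (z : ZMod L) : znorm z ≤ L / 2 := by
  rw [znorm_eq_natAbs]
  exact ZMod.natAbs_valMinAbs_le z

/-- For naturals `τ ≤ τ' ≤ L/2`: `znorm (τ' − τ) = τ' − τ`. -/
theorem znorm_natCast_sub_natCast {τ τ' : ℕ} (h : τ ≤ τ') (h' : τ' ≤ L / 2) :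
    znorm ((τ' : ZMod L) - (τ : ZMod L)) = τ' - τ := by
  rw [← Nat.cast_sub h, znorm_eq_natAbs, ZMod.valMinAbs_natCast_of_le_half (by omega)]
  simp

/-- `#{z : ℤ/L | znorm z ≤ b} ≤ 2b + 1` (inject by `valMinAbs` into `[−b, b]`). -/
theorem card_filter_znorm_le (b : ℕ) :
    #(univ.filter fun z : ZMod L => znorm z ≤ b) ≤ 2 * b + 1 := by
  calc #(univ.filter fun z : ZMod L => znorm z ≤ b)
      ≤ #(Finset.Icc (-(b : ℤ)) b) := by
        refine Finset.card_le_card_of_injOn (fun z : ZMod L => z.valMinAbs) ?_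
          (ZMod.injective_valMinAbs.injOn)
        intro z hz
        simp only [coe_filter, mem_univ, true_and, Set.mem_setOf_eq] at hz
        rw [znorm_eq_natAbs] at hz
        simp only [coe_Icc, Set.mem_Icc]
        omega
    _ = 2 * b + 1 := by
        rw [Int.card_Icc]
        omega

/-- `#{z : ℤ/L | znorm z < ℓ} ≤ 2ℓ` (inject by `valMinAbs` into `(−ℓ, ℓ)`). -/
theorem card_filter_znorm_lt (ℓ : ℕ) :
    #(univ.filter fun z : ZMod L => znorm z < ℓ) ≤ 2 * ℓ := by
  calc #(univ.filter fun z : ZMod L => znorm z < ℓ)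
      ≤ #(Finset.Ioo (-(ℓ : ℤ)) ℓ) := by
        refine Finset.card_le_card_of_injOn (fun z : ZMod L => z.valMinAbs) ?_
          (ZMod.injective_valMinAbs.injOn)
        intro z hz
        simp only [coe_filter, mem_univ, true_and, Set.mem_setOf_eq] at hz
        rw [znorm_eq_natAbs] at hz
        simp only [coe_Ioo, Set.mem_Ioo]
        omega
    _ ≤ 2 * ℓ := by
        rw [Int.card_Ioo]
        omega

end ZNorm

/-! ## §2 Sup-distance of sites and the time displacement along a chain -/

section Chains

variable {L : ℕ} [NeZero L]

omit [NeZero L] in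
/-- Each coordinate's cycle distance is bounded by the sup-distance. -/
theorem znorm_sub_le_siteDist (x y : Site 4 L) (i : Fin 4) : znorm (x i - y i) ≤ siteDist x y :=
  Finset.le_sup (f := fun i : Fin 4 => znorm (x i - y i)) (Finset.mem_univ i)

omit [NeZero L] in
/-- All coordinates at cycle distance `≤ b` iff the sup-distance is `≤ b`. -/
theorem siteDist_le_iff (x y : Site 4 L) (b : ℕ) : siteDist x y ≤ b ↔ ∀ i : Fin 4, znorm (x i - y i) ≤ b := by
  simp [siteDist, Finset.sup_le_iff]

/-- **Time displacement along a chain.**  If consecutive base sites are at sup-distance `≤ 2`, the time coordinate of the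
`i`-th base site is within cycle distance `2i` of the first. -/
theorem znorm_chain_le {k : ℕ} {α : Type*} (c : Fin (k + 1) → Site 4 L × α)
    (hc : ∀ i : Fin k, siteDist (c i.castSucc).1 (c i.succ).1 ≤ 2) (i : Fin (k + 1)) :
    znorm ((c 0).1 0 - (c i).1 0) ≤ 2 * (i : ℕ) := by
  induction i using Fin.induction with
  | zero => simp
  | succ i ih =>
    calc znorm ((c 0).1 0 - (c i.succ).1 0)
        ≤ znorm ((c 0).1 0 - (c i.castSucc).1 0) + znorm ((c i.castSucc).1 0 - (c i.succ).1 0) :=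
          znorm_sub_le _ _ _
      _ ≤ 2 * (i : ℕ) + 2 := by
          have h1 : znorm ((c 0).1 0 - (c i.castSucc).1 0) ≤ 2 * (i : ℕ) := by simpa using ih
          have h2 : znorm ((c i.castSucc).1 0 - (c i.succ).1 0) ≤ 2 :=
            (znorm_sub_le_siteDist _ _ 0).trans (hc i)
          omega
      _ = 2 * (i.succ : ℕ) := by simp [Fin.val_succ]; ring

end Chains

/-! ## §3 Disjointness of chains starting in well-separated boxes of the tube -/

section Disjoint

/-- Ordered case of `disjoint_image_chains`: boxes `j < j'` of the same residue class mod `3`. -/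
theorem disjoint_image_chains_of_lt {S ℓ k m j j' : ℕ} {α : Type*} [DecidableEq α]
    (hmS : m * ℓ ≤ S) (hkℓ : 2 * k ≤ ℓ) (hj' : j' < m) (hlt : j < j') (hmod : j % 3 = j' % 3)
    {c c' : Fin (k + 1) → Site 4 (2 * S + 1) × α}
    (hc0 : (c 0).1 ∈ tubeBox (2 * S + 1) ℓ j) (hc : ∀ i : Fin k, siteDist (c i.castSucc).1 (c i.succ).1 ≤ 2)
    (hc0' : (c' 0).1 ∈ tubeBox (2 * S + 1) ℓ j') (hc' : ∀ i : Fin k, siteDist (c' i.castSucc).1 (c' i.succ).1 ≤ 2) :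
    Disjoint (univ.image c) (univ.image c') := by
  rw [Finset.disjoint_left]
  rintro q hq hq'
  obtain ⟨i, -, rfl⟩ := Finset.mem_image.1 hq
  obtain ⟨i', -, hi'⟩ := Finset.mem_image.1 hq'
  obtain ⟨τ, hτ1, hτ2, hτ⟩ := hc0.1
  obtain ⟨τ', hτ1', hτ2', hτ'⟩ := hc0'.1
  -- the two starting times are `≥ 2ℓ + 1` apart on the cycle
  have hj3 : j + 3 ≤ j' := by omega
  have hprod : (j + 1) * ℓ + 2 * ℓ ≤ j' * ℓ := by nlinarith
  have hττ' : τ + 2 * ℓ + 1 ≤ τ' := by omega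
  have hτ'S : τ' ≤ (2 * S + 1) / 2 := by
    have : (j' + 1) * ℓ ≤ m * ℓ := Nat.mul_le_mul_right _ hj'
    omega
  have hfar : znorm ((c' 0).1 0 - (c 0).1 0) = τ' - τ := by
    rw [hτ, hτ']
    exact znorm_natCast_sub_natCast (by omega) hτ'S
  -- but along the two chains the common plaquette is within `2k` of both starts
  have h1 : znorm ((c 0).1 0 - (c i).1 0) ≤ 2 * k :=
    (znorm_chain_le c hc i).trans (by have := i.is_lt; omega)
  have h2 : znorm ((c' 0).1 0 - (c' i').1 0) ≤ 2 * k :=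
    (znorm_chain_le c' hc' i').trans (by have := i'.is_lt; omega)
  have h3 : znorm ((c' 0).1 0 - (c 0).1 0) ≤ 4 * k := by
    calc znorm ((c' 0).1 0 - (c 0).1 0)
        ≤ znorm ((c' 0).1 0 - (c' i').1 0) + znorm ((c' i').1 0 - (c 0).1 0) := znorm_sub_le _ _ _
      _ ≤ 2 * k + 2 * k := by
          refine Nat.add_le_add h2 ?_
          rw [hi', znorm_sub_comm]
          exact h1
      _ = 4 * k := by ring
  omega

/-- **Disjointness.**  On the torus `(ℤ/(2S+1))⁴` with `m ℓ ≤ S` and `2k ≤ ℓ`: chains of `k+1` plaquettes with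
consecutive base sites at sup-distance `≤ 2`, starting in DIFFERENT tube boxes `j ≠ j'` (`j, j' < m`) of the SAME residue
class mod `3`, have disjoint plaquette sets. -/
theorem disjoint_image_chains {S ℓ k m j j' : ℕ} {α : Type*} [DecidableEq α]
    (hmS : m * ℓ ≤ S) (hkℓ : 2 * k ≤ ℓ) (hj : j < m) (hj' : j' < m) (hne : j ≠ j') (hmod : j % 3 = j' % 3)
    {c c' : Fin (k + 1) → Site 4 (2 * S + 1) × α}
    (hc0 : (c 0).1 ∈ tubeBox (2 * S + 1) ℓ j) (hc : ∀ i : Fin k, siteDist (c i.castSucc).1 (c i.succ).1 ≤ 2)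
    (hc0' : (c' 0).1 ∈ tubeBox (2 * S + 1) ℓ j') (hc' : ∀ i : Fin k, siteDist (c' i.castSucc).1 (c' i.succ).1 ≤ 2) :
    Disjoint (univ.image c) (univ.image c') := by
  rcases lt_or_gt_of_ne hne with hlt | hgt
  · exact disjoint_image_chains_of_lt hmS hkℓ hj' hlt hmod hc0 hc hc0' hc'
  · exact (disjoint_image_chains_of_lt hmS hkℓ hj hgt hmod.symm hc0' hc' hc0 hc).symm

end Disjoint

/-! ## §4 Counting: sites of a tube box, chains starting in a tube box -/

section Count

variable {L : ℕ} [NeZero L]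

omit [NeZero L] in
/-- The time window `[jℓ, (j+1)ℓ)` has at most `ℓ` residues mod `L`. -/
theorem card_image_Ico_le (ℓ j : ℕ) :
    #((Finset.Ico (j * ℓ) ((j + 1) * ℓ)).image (fun τ : ℕ => (τ : ZMod L))) ≤ ℓ := by
  refine Finset.card_image_le.trans ?_
  rw [Nat.card_Ico]
  have : (j + 1) * ℓ = j * ℓ + ℓ := by ring
  omega

open Classical in
/-- **The tube box has at most `8ℓ⁴` sites.** -/
theorem card_filter_tubeBox_le (ℓ j : ℕ) :
    #(univ.filter fun x : Site 4 L => x ∈ tubeBox L ℓ j) ≤ 8 * ℓ ^ 4 := by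
  set T0 : Finset (ZMod L) := (Finset.Ico (j * ℓ) ((j + 1) * ℓ)).image (fun τ : ℕ => (τ : ZMod L)) with hT0
  set Tsp : Finset (ZMod L) := univ.filter fun z : ZMod L => znorm z < ℓ with hTsp
  set t : Fin 4 → Finset (ZMod L) := fun i => if i = 0 then T0 else Tsp with ht
  have hsub : (univ.filter fun x : Site 4 L => x ∈ tubeBox L ℓ j) ⊆ Fintype.piFinset t := by
    intro x hx
    simp only [mem_filter, mem_univ, true_and] at hx
    rw [Fintype.mem_piFinset]
    intro i
    by_cases hi : i = 0
    · subst hi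
      obtain ⟨τ, h1, h2, h3⟩ := hx.1
      simp only [ht, if_true, hT0, Finset.mem_image, Finset.mem_Ico]
      exact ⟨τ, ⟨h1, h2⟩, h3.symm⟩
    · simp only [ht, hi, if_false, hTsp, mem_filter, mem_univ, true_and]
      exact hx.2 i hi
  have h0 : #T0 ≤ ℓ := card_image_Ico_le ℓ j
  have h1 : #Tsp ≤ 2 * ℓ := card_filter_znorm_lt ℓ
  calc #(univ.filter fun x : Site 4 L => x ∈ tubeBox L ℓ j)
      ≤ #(Fintype.piFinset t) := Finset.card_le_card hsub
    _ = #T0 * #Tsp * #Tsp * #Tsp := by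
        rw [Fintype.card_piFinset, Fin.prod_univ_four]
        simp [ht]
    _ ≤ ℓ * (2 * ℓ) * (2 * ℓ) * (2 * ℓ) := by gcongr
    _ = 8 * ℓ ^ 4 := by ring

open Classical in
/-- Sites all of whose coordinates are at cycle distance `≤ 2` from `0`: at most `5⁴ = 625`. -/
theorem card_smallSites_le :
    #(Fintype.piFinset fun _ : Fin 4 => (univ.filter fun z : ZMod L => znorm z ≤ 2)) ≤ 625 := by
  rw [Fintype.card_piFinset_const]
  calc #(univ.filter fun z : ZMod L => znorm z ≤ 2) ^ 4 ≤ 5 ^ 4 :=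
        Nat.pow_le_pow_left (card_filter_znorm_le (L := L) 2) 4
    _ = 625 := by norm_num

open Classical in
/-- **Counting the chains.**  The chains of `k+1` distinct plaquettes of `(ℤ/L)⁴` starting in the tube box `j` of side `ℓ`
(consecutive base sites at sup-distance `≤ 2`) form a finite set of cardinality `≤ 8ℓ⁴·m·(625 m)^k`, `m` the number of
plaquette orientations. -/
theorem exists_chainFinset (k ℓ j : ℕ) :
    ∃ T : Finset (Fin (k + 1) → Plaquette 4 L),
      (∀ c, c ∈ T ↔ (Function.Injective c ∧ (c 0).1 ∈ tubeBox L ℓ j ∧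
          ∀ i : Fin k, siteDist (c i.castSucc).1 (c i.succ).1 ≤ 2)) ∧
      #T ≤ 8 * ℓ ^ 4 * Fintype.card {p : Fin 4 × Fin 4 // p.1 < p.2} *
        (625 * Fintype.card {p : Fin 4 × Fin 4 // p.1 < p.2}) ^ k := by
  set O := {p : Fin 4 × Fin 4 // p.1 < p.2}
  set T : Finset (Fin (k + 1) → Plaquette 4 L) := univ.filter fun c =>
    Function.Injective c ∧ (c 0).1 ∈ tubeBox L ℓ j ∧ ∀ i : Fin k, siteDist (c i.castSucc).1 (c i.succ).1 ≤ 2 with hT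
  refine ⟨T, fun c => by simp [hT], ?_⟩
  -- the coding target
  set B : Finset (Site 4 L) := univ.filter fun x : Site 4 L => x ∈ tubeBox L ℓ j with hB
  set D : Finset (Site 4 L) := Fintype.piFinset fun _ : Fin 4 => (univ.filter fun z : ZMod L => znorm z ≤ 2) with hD
  set tgt : Finset (Plaquette 4 L × (Fin k → Site 4 L × O)) :=
    (B ×ˢ (univ : Finset O)) ×ˢ Fintype.piFinset (fun _ : Fin k => D ×ˢ (univ : Finset O)) with htgt
  -- the difference coding
  set e : (Fin (k + 1) → Plaquette 4 L) → Plaquette 4 L × (Fin k → Site 4 L × O) :=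
    fun c => (c 0, fun i => ((c i.castSucc).1 - (c i.succ).1, (c i.succ).2)) with he
  have hmaps : Set.MapsTo e T tgt := by
    intro c hc
    simp only [hT, coe_filter, mem_univ, true_and, Set.mem_setOf_eq] at hc
    obtain ⟨-, h0, hstep⟩ := hc
    simp only [htgt, he, Finset.mem_coe, Finset.mem_product, Finset.mem_univ, and_true, Fintype.mem_piFinset]
    refine ⟨by simpa [hB] using h0, fun i => ?_⟩
    simp only [hD, Fintype.mem_piFinset, mem_filter, mem_univ, true_and]
    intro a
    exact (znorm_sub_le_siteDist _ _ a).trans (hstep i)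
  have hinj : Set.InjOn e T := by
    intro c _ c' _ hcc'
    simp only [he, Prod.mk.injEq] at hcc'
    obtain ⟨h0, hrest⟩ := hcc'
    have hstep : ∀ i : Fin k, (c i.castSucc).1 - (c i.succ).1 = (c' i.castSucc).1 - (c' i.succ).1 ∧
        (c i.succ).2 = (c' i.succ).2 := fun i => by
      have := congrFun hrest i
      simpa [Prod.mk.injEq] using this
    funext i
    induction i using Fin.induction with
    | zero => exact h0
    | succ i ih =>
      obtain ⟨hd, ho⟩ := hstep i
      refine Prod.ext ?_ ho
      have hci : (c i.castSucc).1 = (c' i.castSucc).1 := by rw [ih]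
      rw [hci] at hd
      exact sub_right_injective hd
  calc #T ≤ #tgt := Finset.card_le_card_of_injOn e hmaps hinj
    _ = #B * Fintype.card O * (#D * Fintype.card O) ^ k := by
        simp only [htgt, Finset.card_product, Fintype.card_piFinset_const, Finset.card_univ]
    _ ≤ 8 * ℓ ^ 4 * Fintype.card O * (625 * Fintype.card O) ^ k := by
        have hB' : #B ≤ 8 * ℓ ^ 4 := card_filter_tubeBox_le ℓ j
        have hD' : #D ≤ 625 := card_smallSites_le
        gcongr

end Count

/-! ## §5 Two elementary facts used by the asymptotics ∕ the residue split -/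

/-- Pigeonhole over the residues mod `3`: some residue class carries a third of `F`. -/
theorem card_le_three_mul_residue (F : Finset ℕ) : ∃ res : ℕ, #F ≤ 3 * #(F.filter fun j => j % 3 = res) := by
  classical
  have hsum : #F = ∑ b ∈ Finset.range 3, #(F.filter fun j => j % 3 = b) :=
    Finset.card_eq_sum_card_fiberwise fun j _ => Finset.mem_range.2 (Nat.mod_lt j (by norm_num))
  by_contra! h
  have hlt : ∑ b ∈ Finset.range 3, 3 * #(F.filter fun j => j % 3 = b) < ∑ _b ∈ Finset.range 3, #F :=
    Finset.sum_lt_sum_of_nonempty ⟨0, by simp⟩ fun b _ => h b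
  rw [Finset.sum_const, Finset.card_range, smul_eq_mul, ← Finset.mul_sum, ← hsum] at hlt
  omega

/-- `⌈x⌉₊ < |x| + 1`. -/
theorem natCeil_lt_abs_add_one (x : ℝ) : (⌈x⌉₊ : ℝ) < |x| + 1 := by
  rcases le_or_gt 0 x with hx | hx
  · rw [abs_of_nonneg hx]
    exact Nat.ceil_lt_add_one hx
  · rw [Nat.ceil_eq_zero.2 hx.le]
    simp only [Nat.cast_zero]
    positivity


end Summit.QuantumFields.YangMills.Cruxes.IR.DefectChain

end
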